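import Summits.QuantumFields.YangMills.Theorems.ColdStartUniversalityLatticeLangevinDiscreteSampling
import Summits.QuantumFields.YangMills.Theorems.ColdStartUniversalityLatticeLangevinMarkovProperty
import Summits.QuantumFields.YangMills.Theorems.ColdStartUniversalityLatticeLangevinInMeasureAlgebra
import HarnessLib

/-!
# Route `ColdStartUniversality` (fixed-cut-off SZZ dynamics, sampler package): ★★★ CONSISTENCY OF THE EMPIRICAL AUTOCOVARIANCE FUNCTION of the
# discretely sampled cold-start chain — how practitioners estimate autocorrelations (and the integrated autocorrelation time) from ONE run

Helper file (seat `ym-line-csu-p1`, g35; `--supports stmt-QuantumFields-24809`).  For every strong solution `U` of the SU(2) SZZ dynamics from a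
deterministic start, every bounded measurable `|G| ≤ 1`, sampling step `h > 0` and lag `J`:
* `integral_sq_sum_le_of_lagOrthogonal` — generic: measurable `|g_k| ≤ B` with `E[g_jg_k] = 0` whenever `j + J ≤ k`, `j < k`, satisfy
  `E[(Σ_(k<N) g_k)²] ≤ N(2J+1)B²`;
* ★★ `integral_sq_lagProduct_average_sub_le` — the MARTINGALE PART: with `ξ_k = G(U_kh)(G(U_(k+J)h) − (κ_JhG)(U_kh))`, orthogonal at lags `≥ J` by
  the Markov property (file 44), `E[(N⁻¹Σ_(k<N) ξ_k)²] ≤ 4(2J+1)/N`;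
* ★★★ `integral_sq_empiricalSecondMoment_sub_le` — `E[(N⁻¹Σ_(k<N) G(U_kh)G(U_(k+J)h) − ∫ G·κ_JhG dμ_(β'))²] ≤ (8(2J+1) + 2(4 + 4Ce^(−ch)/(1−e^(−ch))))/N`
  (every `N ≥ 1`; plus the mean-square ergodic theorem for `G·κ_JhG`, file 55);
* ★★★ `tendstoInMeasure_empiricalAutocovariance` — the EMPIRICAL AUTOCOVARIANCE `φ̂_N(J) = N⁻¹Σ_(k<N) G(U_kh)G(U_(k+J)h) − (N⁻¹Σ_(k<N) G(U_kh))²`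
  converges IN PROBABILITY to `∫ G·κ_JhG dμ_(β') − (μ_(β')G)²` (= the stationary autocovariance `⟨Ĝ, κ_JhĜ⟩_μ` by invariance of `μ_(β')`).
THEOREMS ONLY, no definition, no sorry; [folklore] (Anderson 1971, Ch. 8).
HONEST FRAMING: fixed cut-off; `C, c` depend on `L, β'`; `UniformColdStartMixing` (24809) is NOT restated; no crux, rung or summit statement is
proved; the Yang–Mills mass gap is NOT proved.
-/

set_option autoImplicit false

noncomputable section

namespace Summit.QuantumFields.YangMills.Theorems.ColdStartUniversality

open MeasureTheory ProbabilityTheory Filter Topology Set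
open scoped NNReal ENNReal BigOperators
open Literature Literature.Probability.Process Literature.MathematicalPhysics.QuantumFieldTheory
open Literature.MathematicalPhysics.QuantumLattice (fundamentalRep fundamentalLatticeRep continuous_fundamentalRep)

/-! ## §1. Generic: variance of sums orthogonal beyond a fixed lag -/

/-- ★ **Variance of lag-orthogonal sums**: measurable `|g_k| ≤ B` with `E[g_j g_k] = 0` for `j + J ≤ k`, `j < k` give `E[(Σ_(k<N) g_k)²] ≤ N(2J+1)B²`.
[folklore] -/
theorem integral_sq_sum_le_of_lagOrthogonal {Ω : Type*} [MeasurableSpace Ω] {P : Measure Ω} [IsProbabilityMeasure P]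
    {g : ℕ → Ω → ℝ} (hg : ∀ k, Measurable (g k)) {B : ℝ} (hB : ∀ k ω, |g k ω| ≤ B) (J : ℕ)
    (horth : ∀ j k : ℕ, j + J ≤ k → j < k → ∫ ω, g j ω * g k ω ∂P = 0) :
    ∀ N : ℕ, ∫ ω, (∑ k ∈ Finset.range N, g k ω) ^ 2 ∂P ≤ N * ((2 * J + 1) * B ^ 2)
  | 0 => by simp
  | N + 1 => by
    have ih := integral_sq_sum_le_of_lagOrthogonal hg hB J horth N
    have hSm : ∀ n, Measurable fun ω => ∑ k ∈ Finset.range n, g k ω := fun n => Finset.measurable_sum _ fun k _ => hg k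
    have hSb : ∀ n ω, |∑ k ∈ Finset.range n, g k ω| ≤ n * B := fun n ω =>
      (Finset.abs_sum_le_sum_abs _ _).trans (by
        calc ∑ k ∈ Finset.range n, |g k ω| ≤ ∑ _k ∈ Finset.range n, B := Finset.sum_le_sum fun k _ => hB k ω
          _ = n * B := by rw [Finset.sum_const, Finset.card_range, nsmul_eq_mul])
    have hInt : ∀ {φ ψ : Ω → ℝ} {Cφ Cψ : ℝ}, Measurable φ → Measurable ψ → (∀ ω, |φ ω| ≤ Cφ) → (∀ ω, |ψ ω| ≤ Cψ) →
        Integrable (fun ω => φ ω * ψ ω) P := fun hφ hψ hφb hψb =>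
      (integrable_const _).mono' (hφ.mul hψ).aestronglyMeasurable (Eventually.of_forall fun ω => by
        rw [norm_mul, Real.norm_eq_abs, Real.norm_eq_abs]
        exact mul_le_mul (hφb ω) (hψb ω) (abs_nonneg _) ((abs_nonneg _).trans (hφb ω)))
    have i1 : Integrable (fun ω => (∑ k ∈ Finset.range N, g k ω) ^ 2) P := by
      simpa only [pow_two] using hInt (hSm N) (hSm N) (hSb N) (hSb N)
    have i2 : Integrable (fun ω => (∑ k ∈ Finset.range N, g k ω) * g N ω) P := hInt (hSm N) (hg N) (hSb N) (hB N)
    have i3 : Integrable (fun ω => g N ω * g N ω) P := hInt (hg N) (hg N) (hB N) (hB N)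
    have i2' : Integrable (fun ω => 2 * ((∑ k ∈ Finset.range N, g k ω) * g N ω)) P := i2.const_mul 2
    have i12 : Integrable (fun ω => (∑ k ∈ Finset.range N, g k ω) ^ 2 + 2 * ((∑ k ∈ Finset.range N, g k ω) * g N ω)) P := i1.add i2'
    have hexp : ∫ ω, (∑ k ∈ Finset.range (N + 1), g k ω) ^ 2 ∂P =
        (∫ ω, (∑ k ∈ Finset.range N, g k ω) ^ 2 ∂P) + 2 * (∫ ω, (∑ k ∈ Finset.range N, g k ω) * g N ω ∂P) + ∫ ω, g N ω * g N ω ∂P := by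
      have h1 : ∀ ω, (∑ k ∈ Finset.range (N + 1), g k ω) ^ 2 =
          (∑ k ∈ Finset.range N, g k ω) ^ 2 + 2 * ((∑ k ∈ Finset.range N, g k ω) * g N ω) + g N ω * g N ω := by
        intro ω; rw [Finset.sum_range_succ]; ring
      rw [integral_congr_ae (ae_of_all _ h1), integral_add i12 i3, integral_add i1 i2', integral_const_mul]
    -- each pair product has `|E[g_j g_k]| ≤ B²`
    have hpair : ∀ j k, |∫ ω, g j ω * g k ω ∂P| ≤ B ^ 2 := fun j k => by
      have hh := norm_integral_le_of_norm_le_const (μ := P) (f := fun ω => g j ω * g k ω) (C := B ^ 2)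
        (Eventually.of_forall fun ω => by
          rw [norm_mul, Real.norm_eq_abs, Real.norm_eq_abs, pow_two]
          exact mul_le_mul (hB j ω) (hB k ω) (abs_nonneg _) ((abs_nonneg _).trans (hB j ω)))
      rwa [Real.norm_eq_abs, probReal_univ, mul_one] at hh
    -- the cross term: at most `J` non-zero summands
    have hcross : |∫ ω, (∑ k ∈ Finset.range N, g k ω) * g N ω ∂P| ≤ J * B ^ 2 := by
      have h1 : ∫ ω, (∑ k ∈ Finset.range N, g k ω) * g N ω ∂P = ∑ j ∈ Finset.range N, ∫ ω, g j ω * g N ω ∂P := by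
        rw [← integral_finsetSum _ (fun j _ => hInt (hg j) (hg N) (hB j) (hB N))]
        exact integral_congr_ae (ae_of_all _ fun ω => by simp only [Finset.sum_mul])
      rw [h1]
      refine (Finset.abs_sum_le_sum_abs _ _).trans ?_
      have h2 : ∀ j ∈ Finset.range N, |∫ ω, g j ω * g N ω ∂P| ≤ if N < j + J then B ^ 2 else 0 := fun j hj => by
        split_ifs with hlt
        · exact hpair j N
        · rw [horth j N (not_lt.1 hlt) (Finset.mem_range.1 hj), abs_zero]
      refine (Finset.sum_le_sum h2).trans ?_
      rw [← Finset.sum_filter, Finset.sum_const, nsmul_eq_mul]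
      have hcard : ((Finset.range N).filter (fun j => N < j + J)).card ≤ J := by
        calc ((Finset.range N).filter (fun j => N < j + J)).card ≤ (Finset.Ico (N - J) N).card :=
              Finset.card_le_card fun j hj => by
                simp only [Finset.mem_filter, Finset.mem_range] at hj
                simp only [Finset.mem_Ico]
                omega
          _ ≤ J := by rw [Nat.card_Ico]; omega
      have : (((Finset.range N).filter (fun j => N < j + J)).card : ℝ) ≤ J := by exact_mod_cast hcard
      exact mul_le_mul_of_nonneg_right this (sq_nonneg _)
    have hdiag : ∫ ω, g N ω * g N ω ∂P ≤ B ^ 2 := (le_abs_self _).trans (hpair N N)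
    rw [hexp]
    have hc2 := (abs_le.1 hcross).2
    have hD : (((N + 1 : ℕ) : ℝ)) * ((2 * J + 1) * B ^ 2) = (N : ℝ) * ((2 * J + 1) * B ^ 2) + 2 * (J * B ^ 2) + B ^ 2 := by
      push_cast; ring
    rw [hD]
    exact add_le_add (add_le_add ih (by linarith)) hdiag

/-! ## §2. The empirical autocovariance of the sampled cold-start chain -/

variable {L : ℕ} [NeZero L]

/-- ★★ **The martingale part**: with `ξ_k = G(U_kh)(G(U_(k+J)h) − (κ_JhG)(U_kh))` (orthogonal at lags `≥ J` by the Markov property),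
`E[(N⁻¹Σ_(k<N) ξ_k)²] ≤ 4(2J+1)/N` for `N ≥ 1`. [folklore] -/
theorem integral_sq_lagProduct_average_sub_le (L : ℕ) [NeZero L] (β' : ℝ)
    (κ : ℝ≥0 → Kernel (GaugeConfig 3 L (Matrix.specialUnitaryGroup (Fin 2) ℂ))
      (GaugeConfig 3 L (Matrix.specialUnitaryGroup (Fin 2) ℂ))) [∀ t, IsMarkovKernel (κ t)]
    (hreal : ∀ (t : ℝ≥0) (x : GaugeConfig 3 L (Matrix.specialUnitaryGroup (Fin 2) ℂ))
        (Ω : Type) [MeasurableSpace Ω] (P : Measure Ω) [IsProbabilityMeasure P]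
        (W : ℝ≥0 → Ω → (Edge 3 L × NoiseIdx 2 → ℝ)) (hW : IsFlatBrownian W P)
        (U : ℝ≥0 → Ω → GaugeConfig 3 L (Matrix.specialUnitaryGroup (Fin 2) ℂ)),
        (∀ ω, U 0 ω = x) →
        (latticeLangevinDynamics (fundamentalLatticeRep 2) β').IsSolution (fundamentalRep (Fin 2))
          hW.natFiltration P W U →
        κ t x = P.map (U t))
    (x : GaugeConfig 3 L (Matrix.specialUnitaryGroup (Fin 2) ℂ))
    {Ω : Type} [MeasurableSpace Ω] {P : Measure Ω} [IsProbabilityMeasure P]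
    {W : ℝ≥0 → Ω → (Edge 3 L × NoiseIdx 2 → ℝ)} (hW : IsFlatBrownian W P)
    {U : ℝ≥0 → Ω → GaugeConfig 3 L (Matrix.specialUnitaryGroup (Fin 2) ℂ)} (hU0 : ∀ ω, U 0 ω = x)
    (hU : (latticeLangevinDynamics (fundamentalLatticeRep 2) β').IsSolution (fundamentalRep (Fin 2)) hW.natFiltration P W U)
    {G : GaugeConfig 3 L (Matrix.specialUnitaryGroup (Fin 2) ℂ) → ℝ} (hG : Measurable G) (hG1 : ∀ z, |G z| ≤ 1)
    (h : ℝ≥0) (J N : ℕ) (hN : 1 ≤ N) :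
    ∫ ω, ((N : ℝ)⁻¹ * ∑ k ∈ Finset.range N, G (U ((k : ℝ≥0) * h) ω) *
        (G (U (((k + J : ℕ) : ℝ≥0) * h) ω) - ∫ z, G z ∂(κ ((J : ℝ≥0) * h) (U ((k : ℝ≥0) * h) ω)))) ^ 2 ∂P ≤
      4 * (2 * J + 1) / N := by
  have hmU : ∀ u : ℝ≥0, Measurable (U u) := fun u => (hU.adapted u).mono (hW.natFiltration.le u) le_rfl
  have hκm : Measurable fun y => ∫ z, G z ∂(κ ((J : ℝ≥0) * h) y) := (hG.stronglyMeasurable.integral_kernel (κ := κ ((J : ℝ≥0) * h))).measurable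
  have hκb : ∀ y, |∫ z, G z ∂(κ ((J : ℝ≥0) * h) y)| ≤ 1 := fun y => by
    have hh := norm_integral_le_of_norm_le_const (μ := κ ((J : ℝ≥0) * h) y) (f := G) (C := 1)
      (Eventually.of_forall fun z => by simpa [Real.norm_eq_abs] using hG1 z)
    simpa [Real.norm_eq_abs] using hh
  set ξ : ℕ → Ω → ℝ := fun k ω => G (U ((k : ℝ≥0) * h) ω) *
    (G (U (((k + J : ℕ) : ℝ≥0) * h) ω) - ∫ z, G z ∂(κ ((J : ℝ≥0) * h) (U ((k : ℝ≥0) * h) ω))) with hξ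
  have hξm : ∀ k, Measurable (ξ k) := fun k => (hG.comp (hmU _)).mul ((hG.comp (hmU _)).sub (hκm.comp (hmU _)))
  have hξb : ∀ k ω, |ξ k ω| ≤ 2 := fun k ω => by
    simp only [hξ]
    rw [abs_mul]
    calc |G (U ((k : ℝ≥0) * h) ω)| * |G (U (((k + J : ℕ) : ℝ≥0) * h) ω) - ∫ z, G z ∂(κ ((J : ℝ≥0) * h) (U ((k : ℝ≥0) * h) ω))|
        ≤ 1 * (1 + 1) := mul_le_mul (hG1 _) ((abs_sub _ _).trans (add_le_add (hG1 _) (hκb _))) (abs_nonneg _) zero_le_one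
      _ = 2 := by norm_num
  -- adaptedness: `ξ_j` is measurable for the σ-algebra at lattice time `(j+J)h`
  have hadapt : ∀ (j : ℕ) (u : ℝ≥0), ((j + J : ℕ) : ℝ≥0) * h ≤ u → Measurable[hW.natFiltration u] (ξ j) := by
    intro j u hu
    have h1 : Measurable[hW.natFiltration u] (U ((j : ℝ≥0) * h)) :=
      (hU.adapted _).mono (hW.natFiltration.mono (le_trans (by gcongr; exact_mod_cast Nat.le_add_right j J) hu)) le_rfl
    have h2 : Measurable[hW.natFiltration u] (U (((j + J : ℕ) : ℝ≥0) * h)) := (hU.adapted _).mono (hW.natFiltration.mono hu) le_rfl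
    exact (hG.comp h1).mul ((hG.comp h2).sub (hκm.comp h1))
  -- orthogonality beyond lag `J` (Markov property, file 44)
  have horth : ∀ j k : ℕ, j + J ≤ k → j < k → ∫ ω, ξ j ω * ξ k ω ∂P = 0 := by
    intro j k hjk _
    have hZ : Measurable[hW.natFiltration ((k : ℝ≥0) * h)] fun ω => ξ j ω * G (U ((k : ℝ≥0) * h) ω) :=
      (hadapt j _ (by gcongr)).mul (hG.comp (hU.adapted _))
    have hZb : ∀ ω, |ξ j ω * G (U ((k : ℝ≥0) * h) ω)| ≤ 2 := fun ω => by
      rw [abs_mul]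
      calc |ξ j ω| * |G (U ((k : ℝ≥0) * h) ω)| ≤ 2 * 1 := mul_le_mul (hξb j ω) (hG1 _) (abs_nonneg _) (by norm_num)
        _ = 2 := by norm_num
    have hmk := integral_mul_comp_add_eq_integral_mul_transition β' κ hreal x hW hU0 hU ((k : ℝ≥0) * h) ((J : ℝ≥0) * h) hZ hZb hG hG1
    have hkJ : (k : ℝ≥0) * h + (J : ℝ≥0) * h = ((k + J : ℕ) : ℝ≥0) * h := by push_cast; rw [add_mul]
    rw [hkJ] at hmk
    -- integrability of the two bounded products
    have hZm0 : Measurable fun ω => ξ j ω * G (U ((k : ℝ≥0) * h) ω) := (hξm j).mul (hG.comp (hmU _))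
    have iA : Integrable (fun ω => ξ j ω * G (U ((k : ℝ≥0) * h) ω) * G (U (((k + J : ℕ) : ℝ≥0) * h) ω)) P :=
      (integrable_const (2 * 1 : ℝ)).mono' (hZm0.mul (hG.comp (hmU _))).aestronglyMeasurable
        (Eventually.of_forall fun ω => by
          rw [Real.norm_eq_abs, abs_mul]; exact mul_le_mul (hZb ω) (hG1 _) (abs_nonneg _) (by norm_num))
    have iB : Integrable (fun ω => ξ j ω * G (U ((k : ℝ≥0) * h) ω) * ∫ z, G z ∂(κ ((J : ℝ≥0) * h) (U ((k : ℝ≥0) * h) ω))) P :=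
      (integrable_const (2 * 1 : ℝ)).mono' (hZm0.mul (hκm.comp (hmU _))).aestronglyMeasurable
        (Eventually.of_forall fun ω => by
          rw [Real.norm_eq_abs, abs_mul]; exact mul_le_mul (hZb ω) (hκb _) (abs_nonneg _) (by norm_num))
    have hrew : ∀ ω, ξ j ω * ξ k ω = ξ j ω * G (U ((k : ℝ≥0) * h) ω) * G (U (((k + J : ℕ) : ℝ≥0) * h) ω) -
        ξ j ω * G (U ((k : ℝ≥0) * h) ω) * ∫ z, G z ∂(κ ((J : ℝ≥0) * h) (U ((k : ℝ≥0) * h) ω)) := fun ω => by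
      simp only [hξ]; ring
    rw [integral_congr_ae (ae_of_all _ hrew), integral_sub iA iB, hmk, sub_self]
  have hmain := integral_sq_sum_le_of_lagOrthogonal hξm hξb J horth N
  have hN0 : (0 : ℝ) < N := by exact_mod_cast hN
  have heq : ∀ ω, ((N : ℝ)⁻¹ * ∑ k ∈ Finset.range N, ξ k ω) ^ 2 = (N : ℝ)⁻¹ ^ 2 * (∑ k ∈ Finset.range N, ξ k ω) ^ 2 := fun ω => by ring
  calc ∫ ω, ((N : ℝ)⁻¹ * ∑ k ∈ Finset.range N, ξ k ω) ^ 2 ∂P = (N : ℝ)⁻¹ ^ 2 * ∫ ω, (∑ k ∈ Finset.range N, ξ k ω) ^ 2 ∂P := by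
        rw [integral_congr_ae (ae_of_all _ heq), integral_const_mul]
    _ ≤ (N : ℝ)⁻¹ ^ 2 * (N * ((2 * J + 1) * 2 ^ 2)) := mul_le_mul_of_nonneg_left hmain (sq_nonneg _)
    _ = 4 * (2 * J + 1) / N := by field_simp; ring

/-- ★★★ **Mean-square consistency of the empirical second moments at lag `J`**: for every `N ≥ 1`,
`E[(N⁻¹Σ_(k<N) G(U_kh)G(U_(k+J)h) − ∫ G·κ_JhG dμ_(β'))²] ≤ (8(2J+1) + 2(4 + 4Ce^(−ch)/(1−e^(−ch))))/N`. [folklore] -/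
theorem integral_sq_empiricalSecondMoment_sub_le (L : ℕ) [NeZero L] (β' : ℝ)
    (κ : ℝ≥0 → Kernel (GaugeConfig 3 L (Matrix.specialUnitaryGroup (Fin 2) ℂ))
      (GaugeConfig 3 L (Matrix.specialUnitaryGroup (Fin 2) ℂ))) [∀ t, IsMarkovKernel (κ t)]
    (hreal : ∀ (t : ℝ≥0) (x : GaugeConfig 3 L (Matrix.specialUnitaryGroup (Fin 2) ℂ))
        (Ω : Type) [MeasurableSpace Ω] (P : Measure Ω) [IsProbabilityMeasure P]
        (W : ℝ≥0 → Ω → (Edge 3 L × NoiseIdx 2 → ℝ)) (hW : IsFlatBrownian W P)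
        (U : ℝ≥0 → Ω → GaugeConfig 3 L (Matrix.specialUnitaryGroup (Fin 2) ℂ)),
        (∀ ω, U 0 ω = x) →
        (latticeLangevinDynamics (fundamentalLatticeRep 2) β').IsSolution (fundamentalRep (Fin 2))
          hW.natFiltration P W U →
        κ t x = P.map (U t)) :
    ∃ C c : ℝ, 0 < C ∧ 0 < c ∧
      ∀ (x : GaugeConfig 3 L (Matrix.specialUnitaryGroup (Fin 2) ℂ))
        (Ω : Type) [MeasurableSpace Ω] (P : Measure Ω) [IsProbabilityMeasure P]
        (W : ℝ≥0 → Ω → (Edge 3 L × NoiseIdx 2 → ℝ)) (hW : IsFlatBrownian W P)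
        (U : ℝ≥0 → Ω → GaugeConfig 3 L (Matrix.specialUnitaryGroup (Fin 2) ℂ)),
        (∀ ω, U 0 ω = x) →
        (latticeLangevinDynamics (fundamentalLatticeRep 2) β').IsSolution (fundamentalRep (Fin 2)) hW.natFiltration P W U →
        ∀ (G : GaugeConfig 3 L (Matrix.specialUnitaryGroup (Fin 2) ℂ) → ℝ), Measurable G → (∀ z, |G z| ≤ 1) →
        ∀ (h : ℝ≥0), 0 < h → ∀ (J N : ℕ), 1 ≤ N →
          ∫ ω, ((N : ℝ)⁻¹ * (∑ k ∈ Finset.range N, G (U ((k : ℝ≥0) * h) ω) * G (U (((k + J : ℕ) : ℝ≥0) * h) ω)) -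
              ∫ y, G y * (∫ z, G z ∂(κ ((J : ℝ≥0) * h) y)) ∂(wilsonMeasure (d := 3) (L := L) (fundamentalRep (Fin 2)) β')) ^ 2 ∂P ≤
            (8 * (2 * J + 1) + 2 * (4 + 4 * C * Real.exp (-c * h) / (1 - Real.exp (-c * h)))) / N := by
  obtain ⟨C, c, hC, hc, h55⟩ := integral_sq_average_sub_wilson_le L β'
  refine ⟨C, c, hC, hc, fun x Ω _ P _ W hW U hU0 hU G hG hG1 h hh J N hN => ?_⟩
  set μ : Measure (GaugeConfig 3 L (Matrix.specialUnitaryGroup (Fin 2) ℂ)) :=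
    wilsonMeasure (d := 3) (L := L) (fundamentalRep (Fin 2)) β' with hμ
  have hmU : ∀ u : ℝ≥0, Measurable (U u) := fun u => (hU.adapted u).mono (hW.natFiltration.le u) le_rfl
  have hκm : Measurable fun y => ∫ z, G z ∂(κ ((J : ℝ≥0) * h) y) := (hG.stronglyMeasurable.integral_kernel (κ := κ ((J : ℝ≥0) * h))).measurable
  have hκb : ∀ y, |∫ z, G z ∂(κ ((J : ℝ≥0) * h) y)| ≤ 1 := fun y => by
    have hh' := norm_integral_le_of_norm_le_const (μ := κ ((J : ℝ≥0) * h) y) (f := G) (C := 1)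
      (Eventually.of_forall fun z => by simpa [Real.norm_eq_abs] using hG1 z)
    simpa [Real.norm_eq_abs] using hh'
  -- the observable `H = G · κ_Jh G`
  set H : GaugeConfig 3 L (Matrix.specialUnitaryGroup (Fin 2) ℂ) → ℝ := fun y => G y * ∫ z, G z ∂(κ ((J : ℝ≥0) * h) y) with hH
  have hHm : Measurable H := hG.mul hκm
  have hH1 : ∀ y, |H y| ≤ 1 := fun y => by
    simp only [hH]; rw [abs_mul]
    calc |G y| * |∫ z, G z ∂(κ ((J : ℝ≥0) * h) y)| ≤ 1 * 1 := mul_le_mul (hG1 y) (hκb y) (abs_nonneg _) zero_le_one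
      _ = 1 := one_mul _
  have hA := integral_sq_lagProduct_average_sub_le L β' κ hreal x hW hU0 hU hG hG1 h J N hN
  have hB := h55 x Ω P W hW U hU0 hU H hHm hH1 h hh N hN
  -- the two averages
  set a : Ω → ℝ := fun ω => (N : ℝ)⁻¹ * ∑ k ∈ Finset.range N, G (U ((k : ℝ≥0) * h) ω) *
    (G (U (((k + J : ℕ) : ℝ≥0) * h) ω) - ∫ z, G z ∂(κ ((J : ℝ≥0) * h) (U ((k : ℝ≥0) * h) ω))) with ha
  set b : Ω → ℝ := fun ω => (N : ℝ)⁻¹ * (∑ k ∈ Finset.range N, H (U ((k : ℝ≥0) * h) ω)) - ∫ y, H y ∂μ with hb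
  have ham : Measurable a := (Finset.measurable_sum _ fun k _ =>
    (hG.comp (hmU _)).mul ((hG.comp (hmU _)).sub (hκm.comp (hmU _)))).const_mul _
  have hbm : Measurable b := ((Finset.measurable_sum _ fun k _ => hHm.comp (hmU _)).const_mul _).sub measurable_const
  have hN0 : (0 : ℝ) < N := by exact_mod_cast hN
  -- bounded averages
  have hab : ∀ ω, |a ω| ≤ 2 := fun ω => by
    simp only [ha]
    rw [abs_mul, abs_inv, abs_of_pos hN0]
    have hs : |∑ k ∈ Finset.range N, G (U ((k : ℝ≥0) * h) ω) *
        (G (U (((k + J : ℕ) : ℝ≥0) * h) ω) - ∫ z, G z ∂(κ ((J : ℝ≥0) * h) (U ((k : ℝ≥0) * h) ω)))| ≤ N * 2 := by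
      refine (Finset.abs_sum_le_sum_abs _ _).trans ?_
      calc ∑ k ∈ Finset.range N, |G (U ((k : ℝ≥0) * h) ω) *
            (G (U (((k + J : ℕ) : ℝ≥0) * h) ω) - ∫ z, G z ∂(κ ((J : ℝ≥0) * h) (U ((k : ℝ≥0) * h) ω)))|
          ≤ ∑ _k ∈ Finset.range N, (2 : ℝ) := Finset.sum_le_sum fun k _ => by
              rw [abs_mul]
              calc _ ≤ 1 * (1 + 1) := mul_le_mul (hG1 _) ((abs_sub _ _).trans (add_le_add (hG1 _) (hκb _))) (abs_nonneg _) zero_le_one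
                _ = 2 := by norm_num
        _ = N * 2 := by rw [Finset.sum_const, Finset.card_range, nsmul_eq_mul]
    calc (N : ℝ)⁻¹ * |_| ≤ (N : ℝ)⁻¹ * (N * 2) := mul_le_mul_of_nonneg_left hs (inv_nonneg.2 hN0.le)
      _ = 2 := by field_simp
  have hbb : ∀ ω, |b ω| ≤ 2 := fun ω => by
    haveI : IsProbabilityMeasure μ :=
      isProbabilityMeasure_wilsonMeasure (d := 3) (L := L) (fundamentalRep (Fin 2)) (continuous_fundamentalRep (Fin 2)) β'
    simp only [hb]
    have h1 : |(N : ℝ)⁻¹ * ∑ k ∈ Finset.range N, H (U ((k : ℝ≥0) * h) ω)| ≤ 1 := by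
      rw [abs_mul, abs_inv, abs_of_pos hN0]
      have hs : |∑ k ∈ Finset.range N, H (U ((k : ℝ≥0) * h) ω)| ≤ N * 1 :=
        (Finset.abs_sum_le_sum_abs _ _).trans (by
          calc ∑ k ∈ Finset.range N, |H (U ((k : ℝ≥0) * h) ω)| ≤ ∑ _k ∈ Finset.range N, (1 : ℝ) := Finset.sum_le_sum fun k _ => hH1 _
            _ = N * 1 := by rw [Finset.sum_const, Finset.card_range, nsmul_eq_mul])
      calc (N : ℝ)⁻¹ * |_| ≤ (N : ℝ)⁻¹ * (N * 1) := mul_le_mul_of_nonneg_left hs (inv_nonneg.2 hN0.le)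
        _ = 1 := by field_simp
    have h2 : |∫ y, H y ∂μ| ≤ 1 := by
      have hh' := norm_integral_le_of_norm_le_const (μ := μ) (f := H) (C := 1) (Eventually.of_forall fun y => by simpa [Real.norm_eq_abs] using hH1 y)
      simpa [Real.norm_eq_abs] using hh'
    exact (abs_sub _ _).trans (by linarith)
  have hInt2 : ∀ {φ : Ω → ℝ}, Measurable φ → (∀ ω, |φ ω| ≤ 2) → Integrable (fun ω => φ ω ^ 2) P := fun hφ hφb =>
    (integrable_const (2 ^ 2 : ℝ)).mono' (hφ.pow_const 2).aestronglyMeasurable (Eventually.of_forall fun ω => by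
      rw [Real.norm_eq_abs, abs_pow]; exact pow_le_pow_left₀ (abs_nonneg _) (hφb ω) 2)
  -- the decomposition `statistic = a + b`
  have hdec : ∀ ω, (N : ℝ)⁻¹ * (∑ k ∈ Finset.range N, G (U ((k : ℝ≥0) * h) ω) * G (U (((k + J : ℕ) : ℝ≥0) * h) ω)) - ∫ y, H y ∂μ =
      a ω + b ω := fun ω => by
    simp only [ha, hb, hH, mul_sub, Finset.sum_sub_distrib]
    ring
  calc ∫ ω, ((N : ℝ)⁻¹ * (∑ k ∈ Finset.range N, G (U ((k : ℝ≥0) * h) ω) * G (U (((k + J : ℕ) : ℝ≥0) * h) ω)) - ∫ y, H y ∂μ) ^ 2 ∂P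
      = ∫ ω, (a ω + b ω) ^ 2 ∂P := integral_congr_ae (ae_of_all _ fun ω => by simp only [hdec ω])
    _ ≤ ∫ ω, (2 * a ω ^ 2 + 2 * b ω ^ 2) ∂P := by
        refine integral_mono_of_nonneg (ae_of_all _ fun ω => sq_nonneg _) (((hInt2 ham hab).const_mul 2).add ((hInt2 hbm hbb).const_mul 2))
          (ae_of_all _ fun ω => ?_)
        nlinarith [sq_nonneg (a ω - b ω)]
    _ = 2 * ∫ ω, a ω ^ 2 ∂P + 2 * ∫ ω, b ω ^ 2 ∂P := by
        rw [integral_add ((hInt2 ham hab).const_mul 2) ((hInt2 hbm hbb).const_mul 2), integral_const_mul, integral_const_mul]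
    _ ≤ 2 * (4 * (2 * J + 1) / N) + 2 * ((4 + 4 * C * Real.exp (-c * h) / (1 - Real.exp (-c * h))) / N) := by
        gcongr
    _ = (8 * (2 * J + 1) + 2 * (4 + 4 * C * Real.exp (-c * h) / (1 - Real.exp (-c * h)))) / N := by ring

end Summit.QuantumFields.YangMills.Theorems.ColdStartUniversality

end
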